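import Mathlib
import HarnessLib
import Summits.HubbardSuperconductivity.HubbardSuperconductivity.Theorems.KLProgrammeKLRegimeEngineV8DefsG8
import Summits.HubbardSuperconductivity.HubbardSuperconductivity.Theorems.KLProgrammeKLRegimeEngineE4ScaleDoorFixed

/-!
# K3 ENGINE child (stmt-HubbardSuperconductivity-20437), stub (b) conjunct 3 / v2 token #15: the TARGET of the (E4)ₙ supply chain —
# the level-`n` weighted per-tuple line `WtTupleLineAt` — and the `E4FlowAt` witness it yields

Cell gate-hubbard-kl, seat hubbard-kl-k3c3-p2 (g7); chain of record plan g17 KL STATUS 2026-08-27 l.3017/l.3070: (i) smeared import [W1 + the localisation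
core `…StarConvolutionDiamWeight`] + (ii) frame rows + (iii) per-fixed-external-tuple weighted quartic increment of the top block [E1 part 6 core + the
weighted model side] ⇒ **`WtTupleLineAt L M a b P β U μ (K_n) n`** ⇒ `E4FlowAt` witness ⇒ `klE4Pack` (DefsG8) ⇒ conjunct 3 at `klEngGeo8`.  This file fixes
the target shape and closes the last two arrows:

* §1 **`WtTupleLineAt L M a b P β U μ K n`** — for every anisotropic label 4-tuple `Ω`, the `klScaleWt n`-weighted position sum of the sectorised quartic
  kernel of the frame `K` at scale `n` with leg `0` at the origin is `≤ klE0·(a·(P.Klam·|U|) + b·(P.Klam·U)²)` (`a` ABSOLUTE — the smeared-import constant;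
  `b` the block-increment constant, allowed to read `G, P, R, Q, cc` in the witness theorem); `WtTupleLineAt.mono`;
* §2 `engineFirstMoments_of_wtTupleLineAt` — the line + the fit `a·Klam|U| + b·(Klam U)² ≤ (G.cE4 + Q.cE4|U|)·Klam·|U|` ⇒ (E4) at `(K, n)` (door p521997);
  `e4Fit_of_halves` — `a ≤ E/2`, `|b|·Klam·|U| ≤ E/2`, `E ≤ G.cE4`, `0 ≤ Q.cE4` ⇒ the fit;
* §3 **`e4FlowAt_of_wtTupleLine`** — if the producers deliver the line at `(K_n, n)` under the binders of the registered stub (b) (any well-formed `G, P, R, Q`,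
  their own door `U ≤ u₀ G P R Q cc`), with an absolute `a` and any `b = bfun G P R Q cc`, then `E4FlowAt (2·max a 1) u` with the explicit positive threshold
  `u := min u₀ ((2·max a 1)/(2·(|bfun|·|P.Klam| + 1)))`; **`e4FlowAt_klE4Pack_of_wtTupleLine`** — hence `E4FlowAt klE4TF klE4UF` (the hypothesis of DefsG8's
  consumer `engineFirstMoments_flow_klEngGeo8`).

One definition (a target predicate) + bookkeeping; nothing about the model is asserted; nothing asserts superconductivity.
-/

noncomputable section

namespace Summit.HubbardSuperconductivity.HubbardSuperconductivity.Theorems.EngineV8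

set_option linter.dupNamespace false -- summit = problem name (single-conjunct summit), D-0017

open Real Finset Literature.MathematicalPhysics.QuantumLattice Literature.Probability.LatticeModels
open Literature.Probability.LatticeModels.BattleFederbush
open Summit.HubbardSuperconductivity.HubbardSuperconductivity.Theorems.KLRegimeSplit
open Summit.HubbardSuperconductivity.HubbardSuperconductivity.Theorems.KLProgrammeLegKernels
open Summit.HubbardSuperconductivity.HubbardSuperconductivity.Theorems.DispersionFlow

/-! ## §1 The target: the level-`n` weighted per-tuple line -/

section Model

variable (L M : ℕ) [NeZero L] [NeZero M]

/-- **`WtTupleLineAt L M a b P β U μ K n`** — the level-`n` WEIGHTED PER-TUPLE LINE of the frame `K`: for every anisotropic label 4-tuple `Ω`, the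
`klScaleWt n`-weighted position sum of the sectorised quartic kernel with leg `0` at the origin is `≤ klE0·(a·(P.Klam·|U|) + b·(P.Klam·U)²)`. -/
def WtTupleLineAt (a b : ℝ) (P : SplitConsts) (β U μ : ℝ) (K : TrigPolyC4v) (n : ℕ) : Prop :=
  ∀ Ω : Fin 4 → SectorLeg (sectorCount n),
    imagTimeWeight β M ^ 3 *
        ∑ x : Fin 3 → SpaceTimeIdx L M,
          klScaleWt L M β n ((univ.image (fun j : Fin 4 => (Matrix.vecCons (0 : SpaceTimeIdx L M) x j, Ω j))).image
              (latticeLegPos (2 * (2 * M)))) *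
            ‖klAnisoLegKernel L M β U μ K klE0 n 4 Ω (Matrix.vecCons (0 : SpaceTimeIdx L M) x)‖ ≤
      klE0 * (a * (P.Klam * |U|) + b * (P.Klam * U) ^ 2)

end Model

section Generic

variable {L M : ℕ} [NeZero L] [NeZero M]

/-- A larger `(a, b)` is still a line (`0 ≤ P.Klam`). -/
theorem WtTupleLineAt.mono {a b a' b' : ℝ} {P : SplitConsts} (hK : 0 ≤ P.Klam) {β U μ : ℝ} {K : TrigPolyC4v} {n : ℕ}
    (h : WtTupleLineAt L M a b P β U μ K n) (ha : a ≤ a') (hb : b ≤ b') : WtTupleLineAt L M a' b' P β U μ K n := fun Ω => by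
  refine (h Ω).trans (mul_le_mul_of_nonneg_left ?_ (by norm_num [klE0]))
  have h1 : a * (P.Klam * |U|) ≤ a' * (P.Klam * |U|) := mul_le_mul_of_nonneg_right ha (mul_nonneg hK (abs_nonneg U))
  have h2 : b * (P.Klam * U) ^ 2 ≤ b' * (P.Klam * U) ^ 2 := mul_le_mul_of_nonneg_right hb (sq_nonneg _)
  linarith

/-! ## §2 (E4) from the line and the fit -/

/-- **(E4) at `(K, n)` from the weighted per-tuple line and the fit** `a·Klam|U| + b·(Klam U)² ≤ (G.cE4 + Q.cE4·|U|)·Klam·|U|` (`β > 0`). -/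
theorem engineFirstMoments_of_wtTupleLineAt {β : ℝ} (hβ : 0 < β) {U μ : ℝ} {K : TrigPolyC4v} {n : ℕ} {a b : ℝ}
    {G : GeoConsts} {P : SplitConsts} {Q : EngConsts} (h : WtTupleLineAt L M a b P β U μ K n)
    (hfit : a * (P.Klam * |U|) + b * (P.Klam * U) ^ 2 ≤ (G.cE4 + Q.cE4 * |U|) * P.Klam * |U|) :
    EngineFirstMoments L M G P Q β U μ K n :=
  engineFirstMoments_of_wtSum_fixed hβ fun Ω => (h Ω).trans (mul_le_mul_of_nonneg_left hfit (by norm_num [klE0]))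

/-- **The fit from halves**: `a ≤ E/2`, `|b|·Klam·|U| ≤ E/2`, `E ≤ G.cE4`, `0 ≤ Q.cE4`, `0 ≤ Klam` give
`a·Klam|U| + b·(Klam U)² ≤ (G.cE4 + Q.cE4·|U|)·Klam·|U|`. -/
theorem e4Fit_of_halves {a b E cE4 cE4' Klam U : ℝ} (hK : 0 ≤ Klam) (hc' : 0 ≤ cE4') (ha : a ≤ E / 2) (hb : |b| * Klam * |U| ≤ E / 2)
    (hE : E ≤ cE4) : a * (Klam * |U|) + b * (Klam * U) ^ 2 ≤ (cE4 + cE4' * |U|) * Klam * |U| := by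
  have hU := abs_nonneg U
  have hKU : 0 ≤ Klam * |U| := mul_nonneg hK hU
  have hsq : (Klam * U) ^ 2 = Klam * |U| * (Klam * |U|) := by rw [mul_pow, ← sq_abs U]; ring
  have h1 : a * (Klam * |U|) ≤ E / 2 * (Klam * |U|) := mul_le_mul_of_nonneg_right ha hKU
  have h2 : b * (Klam * U) ^ 2 ≤ E / 2 * (Klam * |U|) := by
    rw [hsq, ← mul_assoc]
    refine mul_le_mul_of_nonneg_right ?_ hKU
    calc b * (Klam * |U|) ≤ |b| * (Klam * |U|) := mul_le_mul_of_nonneg_right (le_abs_self b) hKU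
      _ = |b| * Klam * |U| := by ring
      _ ≤ E / 2 := hb
  have h3 : E * (Klam * |U|) ≤ cE4 * (Klam * |U|) := mul_le_mul_of_nonneg_right hE hKU
  have h4 : 0 ≤ cE4' * |U| * Klam * |U| := by positivity
  nlinarith

/-! ## §3 The `E4FlowAt` witness from the line delivered under the stub binders -/

/-- The explicit threshold of the witness is positive: `0 < min u₀ (E / (2·(|b|·|Klam| + 1)))` (`u₀, E > 0`). -/
theorem e4Threshold_pos {u₀ E b Klam : ℝ} (hu₀ : 0 < u₀) (hE : 0 < E) :
    0 < min u₀ (E / (2 * (|b| * |Klam| + 1))) :=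
  lt_min hu₀ (div_pos hE (by positivity))

/-- Under the threshold, `|b|·Klam·|U| ≤ E/2` (`0 ≤ Klam`, `0 < U ≤ E/(2(|b|·|Klam|+1))`). -/
theorem abs_mul_le_half_of_le_threshold {E b Klam U : ℝ} (hE : 0 ≤ E) (hK : 0 ≤ Klam) (hU : 0 < U)
    (hUle : U ≤ E / (2 * (|b| * |Klam| + 1))) : |b| * Klam * |U| ≤ E / 2 := by
  rw [abs_of_nonneg hK] at hUle
  have hbK : 0 ≤ |b| * Klam := mul_nonneg (abs_nonneg b) hK
  have hden : 0 < 2 * (|b| * Klam + 1) := by positivity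
  rw [abs_of_pos hU]
  have h1 : |b| * Klam * U ≤ |b| * Klam * (E / (2 * (|b| * Klam + 1))) := mul_le_mul_of_nonneg_left hUle hbK
  refine h1.trans ?_
  rw [mul_div_assoc', div_le_iff₀ hden]
  nlinarith

/-- **THE `E4FlowAt` WITNESS FROM THE LINE.**  If for an ABSOLUTE `a` and some `bfun`, `u₀` (the producers' own door, `u₀ > 0`), the level-`n` weighted
per-tuple line holds at the flow frame under the binders of the registered stub (b) — every well-formed `G, P, R, Q`, `0 < cc ≤ klEngC₃6 P R`,
`μ ∈ klWindowC`, `0 < U ≤ u₀ G P R Q cc`, the `β`-window, the volume thresholds, `1 ≤ n ≤ nScales β + 1`, the regime, the history `HistP klPredsV17F2 … n`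
and `FrameOK … (K_n)` — then `E4FlowAt (2·max a 1) (fun G P R Q cc => min (u₀ G P R Q cc) ((2·max a 1)/(2·(|bfun G P R Q cc|·|P.Klam| + 1))))`. -/
theorem e4FlowAt_of_wtTupleLine {a : ℝ} {bfun u₀ : GeoConsts → SplitConsts → RenConsts → EngConsts → ℝ → ℝ}
    (hline : ∀ (G : GeoConsts), G.WF → ∀ (P : SplitConsts) (R : RenConsts) (Q : EngConsts) (cc : ℝ), P.WF → R.WF2 → Q.WF → 0 < cc →
      cc ≤ klEngC₃6 P R → ∀ μ ∈ klWindowC, ∀ U : ℝ, 0 < U → U ≤ u₀ G P R Q cc →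
      ∀ β : ℝ, klBetaMin ≤ β → β ≤ Real.exp (cc / U ^ 2) →
      ∀ (L M : ℕ) [NeZero L] [NeZero M], klEngL₃ β U ≤ L → klEngM₃ β U L ≤ M →
      ∀ n : ℕ, 1 ≤ n → n ≤ nScales β + 1 → IsKLRegime U cc (-(n : ℤ)) →
        HistP klPredsV17F2 L M G P Q R β U μ 0 n → FrameOK R U (nScales β) μ (klFlowFrameU L M β U μ n) →
          WtTupleLineAt L M a (bfun G P R Q cc) P β U μ (klFlowFrameU L M β U μ n) n) :
    E4FlowAt (2 * max a 1) (fun G P R Q cc => min (u₀ G P R Q cc) ((2 * max a 1) / (2 * (|bfun G P R Q cc| * |P.Klam| + 1)))) := by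
  intro G hG hEG P R Q cc hP hR hQ hcc hcc6 μ hμ U hU hUu β hβ hβc L M _ _ hL hM n hn1 hn hreg hhist hfr
  have hK : 0 ≤ P.Klam := le_trans zero_le_one hP.1
  have hE0 : 0 < 2 * max a 1 := by have := le_max_right a 1; linarith
  have hU0 : U ≤ u₀ G P R Q cc := hUu.trans (min_le_left _ _)
  have hU1 : U ≤ (2 * max a 1) / (2 * (|bfun G P R Q cc| * |P.Klam| + 1)) := hUu.trans (min_le_right _ _)
  have hl := hline G hG P R Q cc hP hR hQ hcc hcc6 μ hμ U hU hU0 β hβ hβc L M hL hM n hn1 hn hreg hhist hfr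
  refine engineFirstMoments_of_wtTupleLineAt (lt_of_lt_of_le (by norm_num [klBetaMin] : (0 : ℝ) < klBetaMin) hβ) hl ?_
  refine e4Fit_of_halves hK hQ.2.2.2.1 ?_ (abs_mul_le_half_of_le_threshold hE0.le hK hU hU1) hEG
  have := le_max_left a 1
  linarith

/-- **Hence the engine's package is admissible**: under the hypothesis of `e4FlowAt_of_wtTupleLine` (producers' door `u₀ > 0` pointwise),
`E4FlowAt klE4TF klE4UF` — the hypothesis of DefsG8's consumer `engineFirstMoments_flow_klEngGeo8`. -/
theorem e4FlowAt_klE4Pack_of_wtTupleLine {a : ℝ} {bfun u₀ : GeoConsts → SplitConsts → RenConsts → EngConsts → ℝ → ℝ}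
    (hu₀ : ∀ G P R Q cc, 0 < u₀ G P R Q cc)
    (hline : ∀ (G : GeoConsts), G.WF → ∀ (P : SplitConsts) (R : RenConsts) (Q : EngConsts) (cc : ℝ), P.WF → R.WF2 → Q.WF → 0 < cc →
      cc ≤ klEngC₃6 P R → ∀ μ ∈ klWindowC, ∀ U : ℝ, 0 < U → U ≤ u₀ G P R Q cc →
      ∀ β : ℝ, klBetaMin ≤ β → β ≤ Real.exp (cc / U ^ 2) →
      ∀ (L M : ℕ) [NeZero L] [NeZero M], klEngL₃ β U ≤ L → klEngM₃ β U L ≤ M →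
      ∀ n : ℕ, 1 ≤ n → n ≤ nScales β + 1 → IsKLRegime U cc (-(n : ℤ)) →
        HistP klPredsV17F2 L M G P Q R β U μ 0 n → FrameOK R U (nScales β) μ (klFlowFrameU L M β U μ n) →
          WtTupleLineAt L M a (bfun G P R Q cc) P β U μ (klFlowFrameU L M β U μ n) n) :
    E4FlowAt klE4TF klE4UF := by
  have hE0 : 0 < 2 * max a 1 := by have := le_max_right a 1; linarith
  exact e4FlowAt_klE4Pack hE0.le (fun G P R Q cc => e4Threshold_pos (hu₀ G P R Q cc) hE0) (e4FlowAt_of_wtTupleLine hline)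

end Generic

end Summit.HubbardSuperconductivity.HubbardSuperconductivity.Theorems.EngineV8

end
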